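import Summits.QuantumFields.BalabanUV.T4Continuum.Support.ScalarBlockPoincareLocal
import Summits.QuantumFields.BalabanUV.T4Continuum.Support.FiniteVarianceGluing

/-!
# `BalabanUV.T4Continuum.Support.CoordSlabPoincare` — NE2 (node U1a) formalisation swarm, sub-row `T4-U1a.S-NE2-D1-DIRICHLET°`,
# supplier item «Δ1-HOLEFILL» (brick H-B, part 2 of 3): THE POINCARÉ INEQUALITY ON THE COORDINATE SLABS `{y μ < k}` and `{y μ ≥ 3k}`
# of the cube `Fin d → Fin 4k`, with respect to the bonds INSIDE the slab, by EVEN REFLECTION from the tree's cube inequality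
# (unit b2b-balaban-t4-ne2-formalise-leaf-08, gen 6, file 2)

HONEST FRAMING.  Rung (B)+1 bookkeeping at MODEL level; [folklore] finite lattice calculus; NE2 (U1a) is NOT proved by this file; spine
PROVED 0/9 unchanged; NOT infinite volume, NOT the mass gap, NOT Clay.  HONEST DEPENDENCY (verbatim): «continuum YM on T⁴ ⇐ BetaPertH ∧ nine
spine estimates (0/9 proved); BetaPertH ⇐ (D1) ∧ (D4) ∧ CAP+tail; G-an2-4 gates asym, D1 and NE2/3/4.»

WHAT THIS FILE PROVES (0 sorry).  On the coordinate cube `Fin d → Fin (n+1)` with the successor `stepUp` of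
`Beta.CoordCubePoincare` and the variance `cvar` of `FiniteVarianceGluing`:
 * §1 `dirOn S F` = the Dirichlet form of `F` over the bonds `(y, y + e_μ)` with both ends in `S`; the tree's cube inequality
   `ScalarBlockPoincareLocal.sum_norm_sub_mean_sq_le_cube` in this vocabulary: `cvar univ F ≤ (n(n+1)/2)·dirOn univ F` (`cvar_univ_le`);
 * §2 the low slab `lo μ k = {y : y μ < k}`, the mirror `mir` (`y μ ↦ 2k − 1 − y μ`) and the fold `fold = id on lo k, mir above`:
   the fold is a TWO-TO-ONE COVER `lo μ 2k → lo μ k` (`sum_lo_two`), under which the variance doubles (`cvar_fold`);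
 * §3 **`dirOn_fold`**: the Dirichlet form doubles too — transversal bonds are carried along, the `μ`-bonds of the upper half are the
   mirror images of those of the lower half, and the crease bond `(k−1, k)` carries the difference `F − F = 0`;
 * §4 **`cvar_lo_le`**: for `4k = n + 1`, `cvar (lo μ k) F ≤ (n(n+1)/2)·dirOn (lo μ k) F` (reflect twice, apply the cube inequality to
   the reflected function, divide by `4`); §5 the high slab `hi μ k = {y : y μ ≥ n + 1 − k}` by coordinate reversal (`cvar_hi_le`).
   The constant is the AMBIENT cube's, `(4k−1)·4k/2 ≤ 8k²`, uniform in `d`.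

WHY.  The cube annulus `[0,4k)^d ∖ [k,3k)^d` of Widman's hole-filling step is the union of the `2d` slabs `lo μ k`, `hi μ k`; Poincaré on
each slab + the set algebra of `FiniteVarianceGluing` + a vanishing octant give the annulus inequality (file 3, `CoordAnnulusPoincare`).

ABSOLUTE RULE (cell, verbatim): «No internally-minted statement may enter as a cited fact. Every hypothesis is either kernel-proved in
this package or a verbatim quotation of a PUBLISHED theorem with page reference. The manuscript(s) under audit are NOT citable for
their own disputed steps — they are the thing under adjudication; programme-internal (2001/route/tribunal) claims are never citable.»
[folklore]; plain data `def`s (`dirOn`, `lo`, `hi`, `mir`, `fold`, `revPt`), no `def … : Prop` fact.  NOT CLAIMED: anything analytic; NE2.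
-/

noncomputable section

open scoped BigOperators ComplexConjugate
open Finset

namespace Summit.QuantumFields.BalabanUV.T4Continuum.CoordSlabPoincare

open Literature.MathematicalPhysics.QuantumFieldTheory.Balaban1983to89.Beta.CoordCubePoincare (stepUp)
open Summit.QuantumFields.BalabanUV.T4Continuum.ScalarBlockPoincareLocal (sum_norm_sub_mean_sq_le_cube)
open Summit.QuantumFields.BalabanUV.T4Continuum.FiniteVarianceGluing (cmean cvar cvar_nonneg cvar_comp_of_cover)

variable {n d : ℕ}

/-! ## §1 Dirichlet forms over the bonds inside a set; the cube inequality -/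

/-- the DIRICHLET FORM of `F` over the bonds `(y, y + e_μ)` (`y μ ≠ last`: no wrap) with BOTH ends in `S`. [folklore] -/
def dirOn (S : Finset (Fin d → Fin (n + 1))) (F : (Fin d → Fin (n + 1)) → ℂ) : ℝ :=
  ∑ μ : Fin d, ∑ y ∈ univ.filter (fun y : Fin d → Fin (n + 1) => y μ ≠ Fin.last n ∧ y ∈ S ∧ stepUp y μ ∈ S),
    ‖F (stepUp y μ) - F y‖ ^ 2

/-- `dirOn ≥ 0`. [folklore] -/
theorem dirOn_nonneg (S : Finset (Fin d → Fin (n + 1))) (F : (Fin d → Fin (n + 1)) → ℂ) : 0 ≤ dirOn S F :=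
  Finset.sum_nonneg fun _ _ => Finset.sum_nonneg fun _ _ => sq_nonneg _

/-- **THE CUBE INEQUALITY** (`ScalarBlockPoincareLocal.sum_norm_sub_mean_sq_le_cube`, leaf-01-g4, `d`-free constant) in this file's
vocabulary: `cvar univ F ≤ (n(n+1)/2)·dirOn univ F`. [folklore] -/
theorem cvar_univ_le (F : (Fin d → Fin (n + 1)) → ℂ) : cvar univ F ≤ (n : ℝ) * (n + 1) / 2 * dirOn univ F := by
  have h := sum_norm_sub_mean_sq_le_cube n d F
  have hl : cvar univ F = ∑ y, ‖F y - (∑ y, F y) / (Fintype.card (Fin d → Fin (n + 1)) : ℂ)‖ ^ 2 := by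
    rw [cvar, cmean, Finset.card_univ]
  have hr : dirOn univ F = ∑ μ : Fin d, ∑ y ∈ univ.filter (fun y : Fin d → Fin (n + 1) => y μ ≠ Fin.last n),
      ‖F (stepUp y μ) - F y‖ ^ 2 := by
    unfold dirOn
    refine Finset.sum_congr rfl fun μ _ => Finset.sum_congr ?_ fun _ _ => rfl
    ext y; simp
  rw [hl, hr]; exact h

/-- off the last layer the stepped digit is `y μ + 1`. [folklore] -/
theorem val_stepUp {y : Fin d → Fin (n + 1)} {μ : Fin d} (h : y μ ≠ Fin.last n) : ((stepUp y μ μ : Fin (n + 1)) : ℕ) = y μ + 1 := by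
  rw [stepUp, Function.update_self]
  exact Fin.val_add_one_of_lt (Fin.lt_last_iff_ne_last.mpr h)

/-- the other digits are untouched by `stepUp`. [folklore] -/
theorem stepUp_apply_ne (y : Fin d → Fin (n + 1)) {μ ν : Fin d} (h : ν ≠ μ) : stepUp y μ ν = y ν := by
  rw [stepUp, Function.update_of_ne h]

/-! ## §2 The low slab, the mirror and the fold -/

section Slab

variable (μ : Fin d) (k : ℕ)

/-- the LOW SLAB `{y : y μ < k}` of the coordinate cube. [folklore] -/
def lo : Finset (Fin d → Fin (n + 1)) := univ.filter (fun y : Fin d → Fin (n + 1) => (y μ : ℕ) < k)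

/-- membership in the low slab. [folklore] -/
theorem mem_lo {y : Fin d → Fin (n + 1)} : y ∈ lo (n := n) μ k ↔ (y μ : ℕ) < k := by simp [lo]

/-- a digit from a natural number, reduced mod `n + 1` (used only below `n + 1`, where it is the number itself). [folklore] -/
def mkF (a : ℕ) : Fin (n + 1) := ⟨a % (n + 1), Nat.mod_lt _ (Nat.succ_pos n)⟩

/-- `mkF a = a` below `n + 1`. [folklore] -/
theorem val_mkF_of_lt {a : ℕ} (h : a < n + 1) : ((mkF (n := n) a : Fin (n + 1)) : ℕ) = a := Nat.mod_eq_of_lt h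

/-- the MIRROR in coordinate `μ` about the level `k − ½`: `y μ ↦ 2k − 1 − y μ` (ℕ-truncated; meaningful for `y μ < 2k ≤ n + 1`). [folklore] -/
def mir (y : Fin d → Fin (n + 1)) : Fin d → Fin (n + 1) := Function.update y μ (mkF (n := n) (2 * k - 1 - (y μ : ℕ)))

/-- the FOLD onto the low slab: identity on `lo μ k`, the mirror above it. [folklore] -/
def fold (y : Fin d → Fin (n + 1)) : Fin d → Fin (n + 1) := if (y μ : ℕ) < k then y else mir μ k y

/-- the mirror leaves the other digits alone. [folklore] -/
theorem mir_apply_ne (y : Fin d → Fin (n + 1)) {ν : Fin d} (h : ν ≠ μ) : mir (n := n) μ k y ν = y ν := by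
  rw [mir, Function.update_of_ne h]

/-- the mirrored digit. [folklore] -/
theorem val_mir (hk : 2 * k ≤ n + 1) (y : Fin d → Fin (n + 1)) : ((mir (n := n) μ k y μ : Fin (n + 1)) : ℕ) = 2 * k - 1 - (y μ : ℕ) := by
  rw [mir, Function.update_self, val_mkF_of_lt]
  omega

/-- the fold leaves the other digits alone. [folklore] -/
theorem fold_apply_ne (y : Fin d → Fin (n + 1)) {ν : Fin d} (h : ν ≠ μ) : fold (n := n) μ k y ν = y ν := by
  unfold fold; split_ifs
  · rfl
  · exact mir_apply_ne μ k y h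

/-- the fold lands in the low slab (for `y μ < 2k ≤ n + 1`). [folklore] -/
theorem val_fold_lt (hk : 2 * k ≤ n + 1) {y : Fin d → Fin (n + 1)} (hy : (y μ : ℕ) < 2 * k) : ((fold (n := n) μ k y μ : Fin (n + 1)) : ℕ) < k := by
  unfold fold; split_ifs with h
  · exact h
  · rw [val_mir μ k hk]; omega

/-- the mirror is an involution on `{y μ < 2k}`. [folklore] -/
theorem mir_mir (hk : 2 * k ≤ n + 1) {y : Fin d → Fin (n + 1)} (hy : (y μ : ℕ) < 2 * k) : mir (n := n) μ k (mir μ k y) = y := by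
  funext ν
  by_cases h : ν = μ
  · subst h
    apply Fin.ext
    rw [val_mir ν k hk, val_mir ν k hk]
    omega
  · rw [mir_apply_ne μ k _ h, mir_apply_ne μ k _ h]

/-- **THE FOLD IS A TWO-TO-ONE COVER** `lo μ 2k → lo μ k`: `Σ_{y μ < 2k} g (fold y) = Σ_{y μ < k} g y + Σ_{y μ < k} g y`. [folklore] -/
theorem sum_lo_two (hk : 2 * k ≤ n + 1) {β : Type*} [AddCommMonoid β] (g : (Fin d → Fin (n + 1)) → β) :
    ∑ y ∈ lo (n := n) μ (2 * k), g (fold μ k y) = ∑ y ∈ lo (n := n) μ k, g y + ∑ y ∈ lo (n := n) μ k, g y := by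
  -- split `lo 2k = lo k ∪ mid`
  set mid : Finset (Fin d → Fin (n + 1)) := univ.filter (fun y => k ≤ (y μ : ℕ) ∧ (y μ : ℕ) < 2 * k) with hmid
  have hsplit : lo (n := n) μ (2 * k) = lo μ k ∪ mid := by
    ext y; simp only [mem_lo, hmid, mem_union, mem_filter, mem_univ, true_and]; omega
  have hdisj : Disjoint (lo (n := n) μ k) mid := by
    rw [Finset.disjoint_left]; intro y h1 h2
    rw [mem_lo] at h1; rw [hmid, mem_filter] at h2; omega
  rw [hsplit, Finset.sum_union hdisj]
  congr 1
  · refine Finset.sum_congr rfl fun y hy => ?_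
    rw [mem_lo] at hy; unfold fold; rw [if_pos hy]
  · -- on `mid` the fold is the mirror, a bijection `mid → lo k` (its own inverse)
    have hfm : ∀ y ∈ mid, fold (n := n) μ k y = mir μ k y := fun y hy => by
      rw [hmid, mem_filter] at hy; unfold fold; rw [if_neg (by omega)]
    rw [Finset.sum_congr rfl fun y hy => by rw [hfm y hy]]
    refine Finset.sum_nbij' (mir μ k) (mir μ k) ?_ ?_ ?_ ?_ ?_
    · intro y hy; rw [hmid, mem_filter] at hy; rw [mem_lo, val_mir μ k hk]; omega
    · intro y hy; rw [mem_lo] at hy; rw [hmid, mem_filter, val_mir μ k hk]; refine ⟨mem_univ _, ?_, ?_⟩ <;> omega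
    · intro y hy; rw [hmid, mem_filter] at hy; exact mir_mir μ k hk hy.2.2
    · intro y hy; rw [mem_lo] at hy; exact mir_mir μ k hk (by omega)
    · intro y _; rfl

/-- **THE VARIANCE DOUBLES UNDER THE FOLD**: `cvar (lo μ 2k) (F ∘ fold) = 2·cvar (lo μ k) F` (and the means agree). [folklore] -/
theorem cvar_fold (hk : 2 * k ≤ n + 1) (F : (Fin d → Fin (n + 1)) → ℂ) :
    cvar (lo (n := n) μ (2 * k)) (F ∘ fold μ k) = 2 * cvar (lo (n := n) μ k) F := by
  have h := (cvar_comp_of_cover (s := lo (n := n) μ (2 * k)) (s' := lo (n := n) μ k) (π := fold μ k) (k := 2) two_ne_zero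
    (fun g => by rw [sum_lo_two μ k hk g, Nat.cast_two, two_mul]) F).2
  rw [h, Nat.cast_two]

/-! ## §3 The Dirichlet form doubles under the fold -/

/-- two points agree iff their `μ`-digits and their other digits do. [folklore] -/
theorem ext_of_digit {y y' : Fin d → Fin (n + 1)} (h1 : (y μ : ℕ) = y' μ) (h2 : ∀ ν, ν ≠ μ → y ν = y' ν) : y = y' := by
  funext ν
  by_cases h : ν = μ
  · subst h; exact Fin.ext h1
  · exact h2 ν h

/-- the `ν`-TERM of `dirOn`: the bonds in direction `ν`. [folklore] -/
def dirTerm (S : Finset (Fin d → Fin (n + 1))) (F : (Fin d → Fin (n + 1)) → ℂ) (ν : Fin d) : ℝ :=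
  ∑ y ∈ univ.filter (fun y : Fin d → Fin (n + 1) => y ν ≠ Fin.last n ∧ y ∈ S ∧ stepUp y ν ∈ S), ‖F (stepUp y ν) - F y‖ ^ 2

omit μ k in
/-- `dirOn = Σ_ν dirTerm ν`. [folklore] -/
theorem dirOn_eq_sum_dirTerm (S : Finset (Fin d → Fin (n + 1))) (F : (Fin d → Fin (n + 1)) → ℂ) :
    dirOn S F = ∑ ν, dirTerm S F ν := rfl

omit μ k in
/-- `dirTerm ≥ 0`. [folklore] -/
theorem dirTerm_nonneg (S : Finset (Fin d → Fin (n + 1))) (F : (Fin d → Fin (n + 1)) → ℂ) (ν : Fin d) : 0 ≤ dirTerm S F ν :=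
  Finset.sum_nonneg fun _ _ => sq_nonneg _

/-- the fold commutes with TRANSVERSAL steps. [folklore] -/
theorem fold_stepUp_ne {ν : Fin d} (hν : ν ≠ μ) (y : Fin d → Fin (n + 1)) :
    fold (n := n) μ k (stepUp y ν) = stepUp (fold μ k y) ν := by
  have hμ : stepUp y ν μ = y μ := stepUp_apply_ne y (Ne.symm hν)
  unfold fold
  rw [hμ]
  split_ifs with h
  · rfl
  · funext l
    by_cases hl1 : l = μ
    · subst hl1
      rw [stepUp_apply_ne _ (Ne.symm hν), mir, mir, Function.update_self, Function.update_self, hμ]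
    · by_cases hl2 : l = ν
      · subst hl2
        rw [mir_apply_ne μ k _ hl1, stepUp, stepUp, Function.update_self, Function.update_self, mir_apply_ne μ k _ hl1]
      · rw [mir_apply_ne μ k _ hl1, stepUp_apply_ne _ hl2, stepUp_apply_ne _ hl2, mir_apply_ne μ k _ hl1]

/-- a TRANSVERSAL term over a low slab is a sum over the slab (the slab condition does not see the `ν`-digit). [folklore] -/
theorem dirTerm_lo_ne (m : ℕ) {ν : Fin d} (hν : ν ≠ μ) (G : (Fin d → Fin (n + 1)) → ℂ) :
    dirTerm (lo (n := n) μ m) G ν = ∑ y ∈ lo (n := n) μ m, (if y ν ≠ Fin.last n then ‖G (stepUp y ν) - G y‖ ^ 2 else 0) := by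
  rw [dirTerm]
  have hset : univ.filter (fun y : Fin d → Fin (n + 1) => y ν ≠ Fin.last n ∧ y ∈ lo (n := n) μ m ∧ stepUp y ν ∈ lo (n := n) μ m)
      = (lo (n := n) μ m).filter (fun y : Fin d → Fin (n + 1) => y ν ≠ Fin.last n) := by
    ext y
    simp only [mem_filter, mem_univ, true_and, mem_lo, stepUp_apply_ne y (Ne.symm hν)]
    tauto
  rw [hset, Finset.sum_filter]

/-- **TRANSVERSAL TERMS DOUBLE** under the fold. [folklore] -/
theorem dirTerm_fold_ne (hk : 2 * k ≤ n + 1) {ν : Fin d} (hν : ν ≠ μ) (F : (Fin d → Fin (n + 1)) → ℂ) :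
    dirTerm (lo (n := n) μ (2 * k)) (F ∘ fold μ k) ν = 2 * dirTerm (lo (n := n) μ k) F ν := by
  rw [dirTerm_lo_ne μ (2 * k) hν, dirTerm_lo_ne μ k hν]
  set g : (Fin d → Fin (n + 1)) → ℝ := fun y => if y ν ≠ Fin.last n then ‖F (stepUp y ν) - F y‖ ^ 2 else 0 with hg
  have hrw : ∀ y, (if y ν ≠ Fin.last n then ‖(F ∘ fold μ k) (stepUp y ν) - (F ∘ fold μ k) y‖ ^ 2 else 0) = g (fold μ k y) := by
    intro y
    simp only [hg, Function.comp, fold_stepUp_ne μ k hν, fold_apply_ne μ k y hν]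
  simp_rw [hrw]
  rw [sum_lo_two μ k hk g, two_mul]

/-- the mirror of the stepped point: the reindexing map of the upper-half `μ`-bonds. [folklore] -/
def psi (y : Fin d → Fin (n + 1)) : Fin d → Fin (n + 1) := mir μ k (stepUp y μ)

/-- its `μ`-digit. [folklore] -/
theorem val_psi (hk : 2 * k ≤ n + 1) {y : Fin d → Fin (n + 1)} (hy : (y μ : ℕ) + 1 < 2 * k) :
    ((psi (n := n) μ k y μ : Fin (n + 1)) : ℕ) = 2 * k - 2 - (y μ : ℕ) := by
  have hne : y μ ≠ Fin.last n := by
    intro h; have := congrArg Fin.val h; rw [Fin.val_last] at this; omega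
  rw [psi, val_mir μ k hk, val_stepUp hne]; omega

/-- its other digits. [folklore] -/
theorem psi_apply_ne (y : Fin d → Fin (n + 1)) {ν : Fin d} (hν : ν ≠ μ) : psi (n := n) μ k y ν = y ν := by
  rw [psi, mir_apply_ne μ k _ hν, stepUp_apply_ne _ hν]

/-- `psi` is an involution on `{y μ + 1 < 2k}`. [folklore] -/
theorem psi_psi (hk : 2 * k ≤ n + 1) {y : Fin d → Fin (n + 1)} (hy : (y μ : ℕ) + 1 < 2 * k) : psi (n := n) μ k (psi μ k y) = y := by
  have h1 := val_psi μ k hk hy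
  refine ext_of_digit μ ?_ fun ν hν => by rw [psi_apply_ne μ k _ hν, psi_apply_ne μ k _ hν]
  rw [val_psi μ k hk (by rw [h1]; omega), h1]; omega

/-- on the upper half, the mirror of `y` is the step of `psi y`: the bond `(y, y + e_μ)` maps to the bond `(psi y, psi y + e_μ)` REVERSED. [folklore] -/
theorem mir_eq_stepUp_psi (hk : 2 * k ≤ n + 1) {y : Fin d → Fin (n + 1)} (hy : k ≤ (y μ : ℕ) ∧ (y μ : ℕ) + 1 < 2 * k) :
    mir (n := n) μ k y = stepUp (psi μ k y) μ := by
  have h1 := val_psi μ k hk hy.2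
  have hne : psi (n := n) μ k y μ ≠ Fin.last n := by
    intro h; have := congrArg Fin.val h; rw [Fin.val_last] at this; omega
  refine ext_of_digit μ ?_ fun ν hν => by rw [mir_apply_ne μ k _ hν, stepUp_apply_ne _ hν, psi_apply_ne μ k _ hν]
  rw [val_mir μ k hk, val_stepUp hne, h1]; omega

/-- at the crease the mirror of the stepped point is the point itself. [folklore] -/
theorem mir_stepUp_eq_self (hk : 2 * k ≤ n + 1) {y : Fin d → Fin (n + 1)} (hy : (y μ : ℕ) + 1 = k) :
    mir (n := n) μ k (stepUp y μ) = y := by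
  have h1 := val_psi μ k hk (y := y) (by omega)
  rw [psi] at h1
  refine ext_of_digit μ ?_ fun ν hν => by rw [mir_apply_ne μ k _ hν, stepUp_apply_ne _ hν]
  rw [h1]; omega

/-- the LONGITUDINAL term over a low slab is the sum over `{y μ + 1 < m}`. [folklore] -/
theorem dirTerm_lo_self {m : ℕ} (hm : m ≤ n + 1) (G : (Fin d → Fin (n + 1)) → ℂ) :
    dirTerm (lo (n := n) μ m) G μ = ∑ y ∈ univ.filter (fun y : Fin d → Fin (n + 1) => (y μ : ℕ) + 1 < m), ‖G (stepUp y μ) - G y‖ ^ 2 := by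
  rw [dirTerm]
  refine Finset.sum_congr ?_ fun _ _ => rfl
  ext y
  simp only [mem_filter, mem_univ, true_and, mem_lo]
  constructor
  · rintro ⟨h1, _, h3⟩; rw [val_stepUp h1] at h3; exact h3
  · intro h
    have hne : y μ ≠ Fin.last n := by
      intro h'; have := congrArg Fin.val h'; rw [Fin.val_last] at this; omega
    refine ⟨hne, by omega, ?_⟩; rw [val_stepUp hne]; exact h

/-- **THE LONGITUDINAL TERM DOUBLES** under the fold: lower half verbatim, crease bond zero, upper half = the lower bonds reversed. [folklore] -/
theorem dirTerm_fold_self (hk : 2 * k ≤ n + 1) (F : (Fin d → Fin (n + 1)) → ℂ) :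
    dirTerm (lo (n := n) μ (2 * k)) (F ∘ fold μ k) μ = 2 * dirTerm (lo (n := n) μ k) F μ := by
  rw [dirTerm_lo_self μ hk, dirTerm_lo_self μ (by omega : k ≤ n + 1)]
  set A1 : Finset (Fin d → Fin (n + 1)) := univ.filter (fun y => (y μ : ℕ) + 1 < k) with hA1
  set A2 : Finset (Fin d → Fin (n + 1)) := univ.filter (fun y => (y μ : ℕ) + 1 = k) with hA2
  set A3 : Finset (Fin d → Fin (n + 1)) := univ.filter (fun y => k ≤ (y μ : ℕ) ∧ (y μ : ℕ) + 1 < 2 * k) with hA3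
  have hsplit : univ.filter (fun y : Fin d → Fin (n + 1) => (y μ : ℕ) + 1 < 2 * k) = (A1 ∪ A2) ∪ A3 := by
    ext y; simp only [hA1, hA2, hA3, mem_union, mem_filter, mem_univ, true_and]; omega
  have hd12 : Disjoint A1 A2 := by
    rw [Finset.disjoint_left]; intro y h1 h2; rw [hA1, mem_filter] at h1; rw [hA2, mem_filter] at h2; omega
  have hd3 : Disjoint (A1 ∪ A2) A3 := by
    rw [Finset.disjoint_left]; intro y h1 h2
    rw [mem_union, hA1, hA2, mem_filter, mem_filter] at h1; rw [hA3, mem_filter] at h2; omega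
  rw [hsplit, Finset.sum_union hd3, Finset.sum_union hd12]
  -- lower half: the fold is the identity on both ends
  have e1 : ∑ y ∈ A1, ‖(F ∘ fold μ k) (stepUp y μ) - (F ∘ fold μ k) y‖ ^ 2 = ∑ y ∈ A1, ‖F (stepUp y μ) - F y‖ ^ 2 := by
    refine Finset.sum_congr rfl fun y hy => ?_
    rw [hA1, mem_filter] at hy
    have hne : y μ ≠ Fin.last n := by
      intro h'; have := congrArg Fin.val h'; rw [Fin.val_last] at this; omega
    have hs : ((stepUp y μ μ : Fin (n + 1)) : ℕ) < k := by rw [val_stepUp hne]; exact hy.2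
    simp only [Function.comp, fold, if_pos hs, if_pos (show (y μ : ℕ) < k by omega)]
  -- crease: zero
  have e2 : ∑ y ∈ A2, ‖(F ∘ fold μ k) (stepUp y μ) - (F ∘ fold μ k) y‖ ^ 2 = 0 := by
    refine Finset.sum_eq_zero fun y hy => ?_
    rw [hA2, mem_filter] at hy
    have hne : y μ ≠ Fin.last n := by
      intro h'; have := congrArg Fin.val h'; rw [Fin.val_last] at this; omega
    have hs : ¬ ((stepUp y μ μ : Fin (n + 1)) : ℕ) < k := by rw [val_stepUp hne]; omega
    simp only [Function.comp, fold, if_neg hs, if_pos (show (y μ : ℕ) < k by omega), mir_stepUp_eq_self μ k hk hy.2, sub_self,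
      norm_zero]
    norm_num
  -- upper half: reindex by `psi`
  have e3 : ∑ y ∈ A3, ‖(F ∘ fold μ k) (stepUp y μ) - (F ∘ fold μ k) y‖ ^ 2 = ∑ y ∈ A1, ‖F (stepUp y μ) - F y‖ ^ 2 := by
    have hrw : ∀ y ∈ A3, ‖(F ∘ fold μ k) (stepUp y μ) - (F ∘ fold μ k) y‖ ^ 2 = ‖F (stepUp (psi μ k y) μ) - F (psi μ k y)‖ ^ 2 := by
      intro y hy
      rw [hA3, mem_filter] at hy
      have hne : y μ ≠ Fin.last n := by
        intro h'; have := congrArg Fin.val h'; rw [Fin.val_last] at this; omega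
      have hs : ¬ ((stepUp y μ μ : Fin (n + 1)) : ℕ) < k := by rw [val_stepUp hne]; omega
      simp only [Function.comp, fold, if_neg hs, if_neg (show ¬ (y μ : ℕ) < k by omega)]
      rw [mir_eq_stepUp_psi μ k hk hy.2, ← psi, norm_sub_rev]
    rw [Finset.sum_congr rfl hrw]
    refine Finset.sum_nbij' (psi μ k) (psi μ k) ?_ ?_ ?_ ?_ ?_
    · intro y hy; rw [hA3, mem_filter] at hy; rw [hA1, mem_filter, val_psi μ k hk hy.2.2]; exact ⟨mem_univ _, by omega⟩
    · intro y hy; rw [hA1, mem_filter] at hy; rw [hA3, mem_filter, val_psi μ k hk (by omega)]; refine ⟨mem_univ _, ?_, ?_⟩ <;> omega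
    · intro y hy; rw [hA3, mem_filter] at hy; exact psi_psi μ k hk hy.2.2
    · intro y hy; rw [hA1, mem_filter] at hy; exact psi_psi μ k hk (by omega)
    · intro y _; rfl
  rw [e1, e2, e3]; ring

/-- **THE DIRICHLET FORM DOUBLES UNDER THE FOLD**: `dirOn (lo μ 2k) (F ∘ fold) = 2·dirOn (lo μ k) F`. [folklore] -/
theorem dirOn_fold (hk : 2 * k ≤ n + 1) (F : (Fin d → Fin (n + 1)) → ℂ) :
    dirOn (lo (n := n) μ (2 * k)) (F ∘ fold μ k) = 2 * dirOn (lo (n := n) μ k) F := by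
  rw [dirOn_eq_sum_dirTerm, dirOn_eq_sum_dirTerm, Finset.mul_sum]
  refine Finset.sum_congr rfl fun ν _ => ?_
  by_cases hν : ν = μ
  · subst hν; exact dirTerm_fold_self ν k hk F
  · exact dirTerm_fold_ne μ k hk hν F

/-! ## §4 Poincaré on the low slab -/

/-- **POINCARÉ ON THE LOW SLAB**: for `4k = n + 1`, `cvar (lo μ k) F ≤ (n(n+1)/2)·dirOn (lo μ k) F` — reflect twice (`t → 2t → 4t`), apply
the cube inequality to the reflected function, divide by `4`. [folklore] -/
theorem cvar_lo_le (hk : 4 * k = n + 1) (F : (Fin d → Fin (n + 1)) → ℂ) :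
    cvar (lo (n := n) μ k) F ≤ (n : ℝ) * (n + 1) / 2 * dirOn (lo (n := n) μ k) F := by
  have h2 : 2 * k ≤ n + 1 := by omega
  have h4 : 2 * (2 * k) ≤ n + 1 := by omega
  have huniv : lo (n := n) μ (2 * (2 * k)) = (univ : Finset (Fin d → Fin (n + 1))) := by
    ext y; simp only [mem_lo, mem_univ, iff_true]; have := (y μ).isLt; omega
  set G : (Fin d → Fin (n + 1)) → ℂ := (F ∘ fold μ k) ∘ fold μ (2 * k) with hG
  have hc : cvar univ G = 2 * (2 * cvar (lo (n := n) μ k) F) := by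
    rw [← huniv, hG, cvar_fold μ (2 * k) h4, cvar_fold μ k h2]
  have hd : dirOn univ G = 2 * (2 * dirOn (lo (n := n) μ k) F) := by
    rw [← huniv, hG, dirOn_fold μ (2 * k) h4, dirOn_fold μ k h2]
  have h := cvar_univ_le G
  rw [hc, hd] at h
  have hP : (0 : ℝ) ≤ (n : ℝ) * (n + 1) / 2 := by positivity
  nlinarith [h, dirOn_nonneg (lo (n := n) μ k) F]

end Slab

end Summit.QuantumFields.BalabanUV.T4Continuum.CoordSlabPoincare

end
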